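import Literature.Algebra.Lie.GlSelfAdjointDecomposition
import Mathlib.Algebra.Lie.Semisimple.Lemmas
import Mathlib.Algebra.Lie.Weights.Basic
import Mathlib.FieldTheory.IsAlgClosed.Basic
import HarnessLib

/-!
# An irreducible Lie algebra of skew-adjoint operators of a symplectic form is semisimple
(Humphreys §19.1 ∕ Bourbaki I §6.4 Prop. 5: a Lie algebra with a faithful irreducible TRACE-FREE representation is semisimple)

Mathlib proves the printed statement as `LieAlgebra.hasTrivialRadical_of_isIrreducible_of_isFaithful` (irreducible +
faithful + trace-free ⇒ trivial radical). This file supplies the two hypotheses in the form the Hodge cell's lemma BL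
(crux K1Q) has them, for a Lie subalgebra `L ≤ End(M)` over an algebraically closed field of characteristic `0`:
* **`trace_eq_zero_of_mem_skewAdjointLieSubalgebra`** — members of `𝔰𝔭(M, ω)` (`ω` non-degenerate alternating, `2 ≠ 0`)
  are trace-free: the case `ε = −1` of the tree's `trace_eq_zero_of_isSkewAdjoint` (`GlSelfAdjointDecomposition`);
* `isIrreducible_of_forall_submodule` — the clause «no `L`-stable subspace other than `⊥`, `⊤`» gives Mathlib's
  `LieModule.IsIrreducible K L M` for the tautological action;
* **`hasTrivialRadical_of_irreducible_of_le_skewAdjoint`** — an irreducible `L ≤ 𝔰𝔭(M, ω)` has trivial radical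
  (is semisimple), so Cartan's criterion and `TraceFormFaithful.traceForm_nondegenerate` apply to it.
THEOREMS only. [cite: Humphreys1972, §19.1]
-/

namespace Literature.Algebra.Lie

-- Mathlib's own non-instance `def` for the commutator bracket on an associative ring, enabled LOCALLY exactly as
-- `Mathlib.Algebra.Lie.SkewAdjoint` does.
attribute [local instance 100] LieRing.ofAssociativeRing

namespace IrreducibleSkewAdjoint

open Module LieModule
open LinearMap (BilinForm)

variable {K : Type*} [Field K] {V : Type*} [AddCommGroup V] [Module K V]

section Trace

variable [FiniteDimensional K V]

/-- **Members of `𝔰𝔭(M, ω)` are trace-free** (`ω` non-degenerate alternating, `2 ≠ 0`): the case `ε = −1` of the tree's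
`trace_eq_zero_of_isSkewAdjoint`. [cite: Humphreys1972, §19.1] -/
theorem trace_eq_zero_of_mem_skewAdjointLieSubalgebra {ω : BilinForm K V} (hωn : ω.Nondegenerate) (hω : ω.IsAlt)
    (h2 : (2 : K) ≠ 0) {X : Module.End K V} (hX : X ∈ skewAdjointLieSubalgebra ω) : LinearMap.trace K V X = 0 := by
  haveI : NeZero (2 : K) := ⟨h2⟩
  have hX' : X ∈ ω.skewAdjointSubmodule := hX
  rw [LinearMap.mem_skewAdjointSubmodule] at hX'
  exact trace_eq_zero_of_isSkewAdjoint hωn (ε := -1) (fun u u' => by rw [← LinearMap.IsAlt.neg hω u u', neg_one_mul])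
    (by norm_num) hX'

end Trace

/-- The clause «no `L`-stable subspace other than `⊥`, `⊤`» is Mathlib's `LieModule.IsIrreducible` for the tautological
action of `L ≤ End(M)` (`M ≠ 0`). [cite: Humphreys1972, §19.1] -/
theorem isIrreducible_of_forall_submodule [Nontrivial V] (L : LieSubalgebra K (Module.End K V))
    (h : ∀ W : Submodule K V, (∀ x ∈ L, ∀ w ∈ W, x w ∈ W) → W = ⊥ ∨ W = ⊤) : LieModule.IsIrreducible K L V := by
  refine LieModule.IsIrreducible.mk fun N hN => ?_
  have hstab : ∀ x ∈ L, ∀ w ∈ N.toSubmodule, x w ∈ N.toSubmodule := by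
    intro x hx w hw
    have := N.lie_mem (x := ⟨x, hx⟩) hw
    rwa [LieSubalgebra.coe_bracket_of_module, Module.End.lie_apply] at this
  rcases h N.toSubmodule hstab with hN' | hN'
  · exact absurd ((LieSubmodule.toSubmodule_eq_bot N).mp hN') hN
  · exact (LieSubmodule.toSubmodule_eq_top N).mp hN'

/-- **An irreducible `L ≤ 𝔰𝔭(M, ω)` is semisimple** (`K` algebraically closed of characteristic `0`, `M ≠ 0` finite-dimensional,
`ω` non-degenerate alternating): Mathlib's «faithful irreducible trace-free ⇒ trivial radical».
[cite: Humphreys1972, §19.1] -/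
theorem hasTrivialRadical_of_irreducible_of_le_skewAdjoint [IsAlgClosed K] [CharZero K] [FiniteDimensional K V] [Nontrivial V]
    {ω : BilinForm K V} (hωn : ω.Nondegenerate) (hω : ω.IsAlt) (L : LieSubalgebra K (Module.End K V))
    (hle : L ≤ skewAdjointLieSubalgebra ω)
    (hirr : ∀ W : Submodule K V, (∀ x ∈ L, ∀ w ∈ W, x w ∈ W) → W = ⊥ ∨ W = ⊤) :
    LieAlgebra.HasTrivialRadical K L := by
  haveI : LieModule.IsIrreducible K L V := isIrreducible_of_forall_submodule L hirr
  haveI : Module.Finite K L := inferInstanceAs (Module.Finite K L.toSubmodule)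
  refine LieAlgebra.hasTrivialRadical_of_isIrreducible_of_isFaithful K L V fun x => ?_
  have hx : toEnd K L V x = (x : Module.End K V) := by ext m; rfl
  rw [hx]
  exact trace_eq_zero_of_mem_skewAdjointLieSubalgebra hωn hω two_ne_zero (hle x.2)

end IrreducibleSkewAdjoint

end Literature.Algebra.Lie
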